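import Mathlib
import Summits.QuantumFields.BalabanUV.T4Continuum.Support.SliceFlatGradient
import Summits.QuantumFields.BalabanUV.Beta.GAN24.SliceFlatHessian

/-!
# G-an2-4 ∕ (CONV-C), the SECOND-ORDER sup entries — THE ABSTRACT FLAT RESOLVENT STEP, part (i): the translation dictionary and the
# weighted rows of the four FREE pieces `∇_νF`, `F·colDiff ν`, `∇_μ∇_νF`, `F·colDiff μ·colDiff ν` of the massive unit-lattice resolvent
# `F = freeOp j` on the NE3 carrier (the located `1 + log n` enters here, from leaf-03 gen 48's (C)∕(D) `SliceFlatFreeHessian`∕`SliceFlatHessian`)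

G-an2-4 formalisation swarm `b2b-balaban-gan24-formalise-*`, leaf prover 06 (gen 35), crux team (2) under the coordinator ruling
«YM REDIRECT» (e34b3e0c); INTERFACE REQUEST G-an2-4 (SCALAR-LETTERS for `Gps`), WORD α (HOME/INBOX.md 2026-08-21T08:13Z).  The
abstract resolvent step (sequel `GAN24/FlatResolventStep.resolventStep_bounds`: for ANY inverse `Gs` of `stencilE + Ms` with zeroth-order
cube rows `≤ C_G·n²`, first-order rows `≤ B·n`, second-order rows `≤ B·(1 + log n)`) needs, about the FREE operator only:
 * §1 translation dictionary and weight shifts: `freeOp_translate`, **`freeOp_colDiff_eq`** `(F·colDiff ν)(z,x) = −rowDiff ν F((z₁ − e_ν, z₂), x)`,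
   **`freeOp_colDiff2_eq`**, `rhoI_shift1_le` ∕ `rhoI_shift2_le` (a unit ∕ double unit row shift has fine length `≤ 1` ∕ `≤ 2`),
   **`wE_shift_le`** (a row shift of fine length `≤ r` costs `≤ e^{rδ}` in the weight `wE`);
 * §2 the weighted rows of the four free pieces (`j ≤ k`, `0 ≤ δ < freeα d`): (F1ᶜ) `weightedRow_freeOp_colDiff` (from NE3 part 13's
   `weightedRow_rowDiff_freeOp`, cost `e^{δ}`), (F2) = leaf-03 gen 48's (D)
   `SliceFlatHessian.weightedRow_rowDiff_rowDiff_freeOp` BY NAME (`≤ 106000·48^d·(1 + log L^j)·e^{δ(d+1)}·2^{d+1}·countConst(freeα d − δ, d+1)`,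
   the located log, from their (C) `SliceFlatFreeHessian.cubeSum_rowDiff_rowDiff_freeOp_le`), and (F2ᶜ) `weightedRow_freeOp_colDiff2`
   (cost `e^{2δ}`).

HONEST SCOPE.  [folklore] finite-dimensional bookkeeping over tree modules BY NAME (NE3 lineage parts 11–13, leaf-03's (C)); no `def`, no
`def … : Prop`, no `sorry`.  NOT (CONV-C), NEVER «G-an2-4 closed», NOT NE2 ∕ NE3, NOT D1, NOT BetaPertH, NOT continuum, NOT Clay; not in
print — our bookkeeping.  ABSOLUTE RULE of the cell kept.  HONEST DEPENDENCY: continuum YM on T⁴ ⇐ BetaPertH ∧ nine spine estimates (0/9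
proved); BetaPertH ⇐ (D1) ∧ (D4) ∧ CAP+tail; G-an2-4 gates asym, D1 and NE2/3/4.
-/

noncomputable section

open Real Finset Matrix

namespace Summit.QuantumFields.BalabanUV.Beta.GAN24.FlatResolventPieces

open Literature.MathematicalPhysics.QuantumFieldTheory.Balaban1983to89
open Literature.MathematicalPhysics.QuantumFieldTheory.Balaban1983to89.TreeLengthTorus (TPt)
open Literature.MathematicalPhysics.QuantumFieldTheory.Balaban1983to89.T4SliceOperatorData (countConst countConst_pos)
open Literature.MathematicalPhysics.QuantumFieldTheory.Balaban1983to89.B12Decay510Torus (pabs pabs_nonneg pabs_add_le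
  pabs_le_abs_of_cast_eq pl1_eq_sum)
open Summit.QuantumFields.BalabanUV.T4Continuum
open SliceTorusBlocks SliceTorusTower SliceCovariantTower SliceFlatPropagator SliceFlatOperators SliceFlatStencil
open SliceFlatGaugeDecay SliceFlatFreeResolvent SliceFlatGradientPrep SliceFlatGradient
open Summit.QuantumFields.BalabanUV.Beta.GAN24.SliceFlatHessian (weightedRow_rowDiff_rowDiff_freeOp)

variable (d k N L : ℕ) [NeZero N] [NeZero L]

/-! ## §1  Translation dictionary and weight shifts for the free operator -/
section Translation

/-- Translation invariance of the free operator: `F((a+s,c),(b+s,c′)) = F((a,c),(b,c′))`. [folklore] -/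
theorem freeOp_translate (j : ℕ) (a b s : TPt (d + 1) (N * L ^ k)) (c c' : Fin (d + 1)) :
    freeOp d k N L j (a + s, c) (b + s, c') = freeOp d k N L j (a, c) (b, c') := by
  simp only [freeOp, add_sub_add_right_eq_sub]

/-- The unit forward COLUMN difference of the free operator at row `z` is minus its unit forward ROW difference at the row shifted back
by `e_ν`: `(F·colDiff ν)(z,x) = −rowDiff ν F ((z₁ − e_ν, z₂), x)`. [folklore] -/
theorem freeOp_colDiff_eq (j : ℕ) (ν : Fin (d + 1)) (z x : TPt (d + 1) (N * L ^ k) × Fin (d + 1)) :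
    (freeOp d k N L j * colDiff d k N L ν) z x = -rowDiff d k N L ν (freeOp d k N L j) (z.1 - Pi.single ν 1, z.2) x := by
  rw [mul_colDiff_apply]
  simp only [rowDiff]
  have e1 : freeOp d k N L j z (x.1 + Pi.single ν 1, x.2) = freeOp d k N L j (z.1 - Pi.single ν 1, z.2) x := by
    have h := freeOp_translate d k N L j (z.1 - Pi.single ν 1) x.1 (Pi.single ν 1) z.2 x.2
    rw [show z.1 - Pi.single ν 1 + Pi.single ν 1 = z.1 by abel] at h
    rw [← h]
  have e2 : freeOp d k N L j z x = freeOp d k N L j (z.1 - Pi.single ν 1 + Pi.single ν 1, z.2) x := by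
    rw [show z.1 - Pi.single ν 1 + Pi.single ν 1 = z.1 by abel]
  rw [e1, e2]
  ring

/-- The double unit forward COLUMN difference of the free operator at row `z` is its double unit forward ROW difference at the row
shifted back by `e_μ + e_ν`: `(F·colDiff μ·colDiff ν)(z,x) = rowDiff μ (rowDiff ν F)((z₁ − e_μ − e_ν, z₂), x)`. [folklore] -/
theorem freeOp_colDiff2_eq (j : ℕ) (μ ν : Fin (d + 1)) (z x : TPt (d + 1) (N * L ^ k) × Fin (d + 1)) :
    (freeOp d k N L j * colDiff d k N L μ * colDiff d k N L ν) z x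
      = rowDiff d k N L μ (rowDiff d k N L ν (freeOp d k N L j)) (z.1 - Pi.single μ 1 - Pi.single ν 1, z.2) x := by
  rw [mul_colDiff_apply, mul_colDiff_apply, mul_colDiff_apply]
  simp only [rowDiff]
  have e1 : freeOp d k N L j z (x.1 + Pi.single ν 1 + Pi.single μ 1, x.2)
      = freeOp d k N L j (z.1 - Pi.single μ 1 - Pi.single ν 1, z.2) x := by
    have h := freeOp_translate d k N L j (z.1 - Pi.single μ 1 - Pi.single ν 1) x.1 (Pi.single ν 1 + Pi.single μ 1) z.2 x.2
    rw [show z.1 - Pi.single μ 1 - Pi.single ν 1 + (Pi.single ν 1 + Pi.single μ 1) = z.1 by abel,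
      show x.1 + (Pi.single ν 1 + Pi.single μ 1) = x.1 + Pi.single ν 1 + Pi.single μ 1 by abel] at h
    rw [← h]
  have e2 : freeOp d k N L j z (x.1 + Pi.single ν 1, x.2)
      = freeOp d k N L j (z.1 - Pi.single μ 1 - Pi.single ν 1 + Pi.single μ 1, z.2) x := by
    have h := freeOp_translate d k N L j (z.1 - Pi.single μ 1 - Pi.single ν 1 + Pi.single μ 1) x.1 (Pi.single ν 1) z.2 x.2
    rw [show z.1 - Pi.single μ 1 - Pi.single ν 1 + Pi.single μ 1 + Pi.single ν 1 = z.1 by abel] at h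
    rw [← h]
  have e3 : freeOp d k N L j z (x.1 + Pi.single μ 1, x.2)
      = freeOp d k N L j (z.1 - Pi.single μ 1 - Pi.single ν 1 + Pi.single ν 1, z.2) x := by
    have h := freeOp_translate d k N L j (z.1 - Pi.single μ 1 - Pi.single ν 1 + Pi.single ν 1) x.1 (Pi.single μ 1) z.2 x.2
    rw [show z.1 - Pi.single μ 1 - Pi.single ν 1 + Pi.single ν 1 + Pi.single μ 1 = z.1 by abel] at h
    rw [← h]
  have e4 : freeOp d k N L j z x
      = freeOp d k N L j (z.1 - Pi.single μ 1 - Pi.single ν 1 + Pi.single μ 1 + Pi.single ν 1, z.2) x := by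
    rw [show z.1 - Pi.single μ 1 - Pi.single ν 1 + Pi.single μ 1 + Pi.single ν 1 = z.1 by abel]
  rw [e1, e2, e3, e4]
  ring

/-- Each coordinate of a unit vector has periodic absolute value at most the indicator of its index. [folklore] -/
theorem pabs_single_le (κ i : Fin (d + 1)) :
    (pabs ((Pi.single κ (1 : ZMod (N * L ^ k)) : TPt (d + 1) (N * L ^ k)) i) : ℝ) ≤ if i = κ then 1 else 0 := by
  by_cases h : i = κ
  · subst h
    rw [Pi.single_eq_same, if_pos rfl]
    have := pabs_le_abs_of_cast_eq (T := N * L ^ k) (a := (1 : ZMod (N * L ^ k))) (x := 1) (by push_cast; rfl)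
    exact_mod_cast this.trans (le_of_eq abs_one)
  · rw [Pi.single_eq_of_ne h, if_neg h, B12Decay510Torus.pabs_zero]; simp

/-- The fine distance of a single unit shift: `ρ(z, (z₁ − e_ν, z₂)) ≤ 1`. [folklore] -/
theorem rhoI_shift1_le (ν : Fin (d + 1)) (z : TPt (d + 1) (N * L ^ k) × Fin (d + 1)) :
    rhoI (d + 1) k N L (Fin (d + 1)) z (z.1 - Pi.single ν 1, z.2) ≤ 1 := by
  unfold rhoI rho
  rw [show z.1 - (z.1 - Pi.single ν 1) = Pi.single ν 1 by abel, pl1_eq_sum]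
  calc ∑ i, (pabs ((Pi.single ν (1 : ZMod (N * L ^ k)) : TPt (d + 1) (N * L ^ k)) i) : ℝ)
      ≤ ∑ i : Fin (d + 1), (if i = ν then (1 : ℝ) else 0) := Finset.sum_le_sum fun i _ => pabs_single_le d k N L ν i
    _ = 1 := by rw [Finset.sum_ite_eq']; simp

/-- The fine distance of a double unit shift: `ρ(z, (z₁ − e_μ − e_ν, z₂)) ≤ 2`. [folklore] -/
theorem rhoI_shift2_le (μ ν : Fin (d + 1)) (z : TPt (d + 1) (N * L ^ k) × Fin (d + 1)) :
    rhoI (d + 1) k N L (Fin (d + 1)) z (z.1 - Pi.single μ 1 - Pi.single ν 1, z.2) ≤ 2 := by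
  unfold rhoI rho
  rw [show z.1 - (z.1 - Pi.single μ 1 - Pi.single ν 1) = Pi.single μ 1 + Pi.single ν 1 by abel, pl1_eq_sum]
  calc ∑ i, (pabs ((Pi.single μ (1 : ZMod (N * L ^ k)) + Pi.single ν 1 : TPt (d + 1) (N * L ^ k)) i) : ℝ)
      ≤ ∑ i : Fin (d + 1), ((if i = μ then (1 : ℝ) else 0) + (if i = ν then (1 : ℝ) else 0)) := by
        refine Finset.sum_le_sum fun i _ => ?_
        rw [Pi.add_apply]
        have h := pabs_add_le ((Pi.single μ (1 : ZMod (N * L ^ k)) : TPt (d + 1) (N * L ^ k)) i)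
          ((Pi.single ν (1 : ZMod (N * L ^ k)) : TPt (d + 1) (N * L ^ k)) i)
        have h' : (pabs ((Pi.single μ (1 : ZMod (N * L ^ k)) : TPt (d + 1) (N * L ^ k)) i
            + (Pi.single ν (1 : ZMod (N * L ^ k)) : TPt (d + 1) (N * L ^ k)) i) : ℝ)
            ≤ (pabs ((Pi.single μ (1 : ZMod (N * L ^ k)) : TPt (d + 1) (N * L ^ k)) i) : ℝ)
              + (pabs ((Pi.single ν (1 : ZMod (N * L ^ k)) : TPt (d + 1) (N * L ^ k)) i) : ℝ) := by exact_mod_cast h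
        exact h'.trans (add_le_add (pabs_single_le d k N L μ i) (pabs_single_le d k N L ν i))
    _ = 2 := by
        rw [Finset.sum_add_distrib, Finset.sum_ite_eq', Finset.sum_ite_eq']
        simp; norm_num

/-- **The weight shift**: a row shift of fine length `≤ r` costs at most `e^{rδ}` in the weight `wE` (`δ ≥ 0`, `n ≥ 1`). [folklore] -/
theorem wE_shift_le (j : ℕ) {δ : ℝ} (hδ : 0 ≤ δ) {r : ℝ} (z z' x : TPt (d + 1) (N * L ^ k) × Fin (d + 1))
    (hr : rhoI (d + 1) k N L (Fin (d + 1)) z z' ≤ r) :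
    wE d k N L j δ z x ≤ Real.exp (r * δ) * wE d k N L j δ z' x := by
  have hn1 : (1 : ℝ) ≤ (side k L j : ℝ) := by exact_mod_cast one_le_side k L j
  have hn0 : (0 : ℝ) < (side k L j : ℝ) := by linarith
  unfold wE
  rw [← Real.exp_add]
  refine Real.exp_le_exp.2 ?_
  have htri := rhoI_triangle3 d k N L z z' x
  have hρ0 : 0 ≤ rhoI (d + 1) k N L (Fin (d + 1)) z' x := by unfold rhoI; exact rho_nonneg _ _ _ _ _ _
  have hr0 : 0 ≤ r := le_trans (by unfold rhoI; exact rho_nonneg _ _ _ _ _ _) hr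
  rw [div_eq_mul_inv, div_eq_mul_inv]
  have hinv : (side k L j : ℝ)⁻¹ ≤ 1 := inv_le_one_of_one_le₀ hn1
  have hinv0 : 0 ≤ (side k L j : ℝ)⁻¹ := inv_nonneg.2 hn0.le
  have hds : 0 ≤ δ * (side k L j : ℝ)⁻¹ := mul_nonneg hδ hinv0
  have hds1 : δ * (side k L j : ℝ)⁻¹ ≤ δ := by nlinarith
  calc δ * (rhoI (d + 1) k N L (Fin (d + 1)) z x * (side k L j : ℝ)⁻¹)
      = (δ * (side k L j : ℝ)⁻¹) * rhoI (d + 1) k N L (Fin (d + 1)) z x := by ring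
    _ ≤ (δ * (side k L j : ℝ)⁻¹) * (r + rhoI (d + 1) k N L (Fin (d + 1)) z' x) :=
        mul_le_mul_of_nonneg_left (htri.trans (by linarith)) hds
    _ = r * (δ * (side k L j : ℝ)⁻¹) + δ * (rhoI (d + 1) k N L (Fin (d + 1)) z' x * (side k L j : ℝ)⁻¹) := by ring
    _ ≤ r * δ + δ * (rhoI (d + 1) k N L (Fin (d + 1)) z' x * (side k L j : ℝ)⁻¹) := by nlinarith

end Translation

/-! ## §2  Weighted rows of the four free pieces -/
section FreePieces

/-- (F1ᶜ) **Weighted rows of `F·colDiff ν`** (`j ≤ k`, `0 ≤ δ < freeα d`): `≤ e^{δ}·freeC d·L^j·e^{δ(d+1)}·2^{d+1}·countConst(freeα d − δ, d+1)`.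
[folklore] -/
theorem weightedRow_freeOp_colDiff {j : ℕ} (hj : j ≤ k) (ν : Fin (d + 1)) {δ : ℝ} (hδ : 0 ≤ δ) (hδ₀ : δ < freeα d)
    (z : TPt (d + 1) (N * L ^ k) × Fin (d + 1)) :
    ∑ x, |(freeOp d k N L j * colDiff d k N L ν) z x| * wE d k N L j δ z x
      ≤ Real.exp δ * (freeC d * (L : ℝ) ^ j * Real.exp (δ * (d + 1)) * ((2 : ℝ) ^ (d + 1) * countConst (freeα d - δ) (d + 1))) := by
  set p : TPt (d + 1) (N * L ^ k) × Fin (d + 1) := (z.1 - Pi.single ν 1, z.2) with hp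
  have h := weightedRow_rowDiff_freeOp d k N L hj ν hδ hδ₀ p
  have hshift : ∀ x, wE d k N L j δ z x ≤ Real.exp (1 * δ) * wE d k N L j δ p x := fun x =>
    wE_shift_le d k N L j hδ z p x (rhoI_shift1_le d k N L ν z)
  calc ∑ x, |(freeOp d k N L j * colDiff d k N L ν) z x| * wE d k N L j δ z x
      ≤ ∑ x, |rowDiff d k N L ν (freeOp d k N L j) p x| * (Real.exp (1 * δ) * wE d k N L j δ p x) := by
        refine Finset.sum_le_sum fun x _ => ?_
        rw [freeOp_colDiff_eq, abs_neg]
        exact mul_le_mul_of_nonneg_left (hshift x) (abs_nonneg _)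
    _ = Real.exp δ * ∑ x, |rowDiff d k N L ν (freeOp d k N L j) p x| * wE d k N L j δ p x := by
        rw [one_mul, Finset.mul_sum]; exact Finset.sum_congr rfl fun x _ => by ring
    _ ≤ _ := mul_le_mul_of_nonneg_left h (Real.exp_pos _).le

/-- (F2ᶜ) **Weighted rows of `F·colDiff μ·colDiff ν`** (`j ≤ k`, `0 ≤ δ < freeα d`): the translation dictionary and the weight shift
turn them into (F2) at the shifted row, at the cost `e^{2δ}`. [folklore] -/
theorem weightedRow_freeOp_colDiff2 {j : ℕ} (hj : j ≤ k) (μ ν : Fin (d + 1)) {δ : ℝ} (hδ : 0 ≤ δ) (hδ₀ : δ < freeα d)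
    (z : TPt (d + 1) (N * L ^ k) × Fin (d + 1)) :
    ∑ x, |(freeOp d k N L j * colDiff d k N L μ * colDiff d k N L ν) z x| * wE d k N L j δ z x
      ≤ Real.exp (2 * δ) * (106000 * 48 ^ d * (1 + Real.log ((L : ℝ) ^ j)) * Real.exp (δ * (d + 1)) *
          ((2 : ℝ) ^ (d + 1) * countConst (freeα d - δ) (d + 1))) := by
  set p : TPt (d + 1) (N * L ^ k) × Fin (d + 1) := (z.1 - Pi.single μ 1 - Pi.single ν 1, z.2) with hp
  have h := weightedRow_rowDiff_rowDiff_freeOp d k N L hj μ ν hδ hδ₀ p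
  have hshift : ∀ x, wE d k N L j δ z x ≤ Real.exp (2 * δ) * wE d k N L j δ p x := fun x =>
    wE_shift_le d k N L j hδ z p x (rhoI_shift2_le d k N L μ ν z)
  calc ∑ x, |(freeOp d k N L j * colDiff d k N L μ * colDiff d k N L ν) z x| * wE d k N L j δ z x
      ≤ ∑ x, |rowDiff d k N L μ (rowDiff d k N L ν (freeOp d k N L j)) p x| * (Real.exp (2 * δ) * wE d k N L j δ p x) := by
        refine Finset.sum_le_sum fun x _ => ?_
        rw [freeOp_colDiff2_eq]
        exact mul_le_mul_of_nonneg_left (hshift x) (abs_nonneg _)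
    _ = Real.exp (2 * δ) * ∑ x, |rowDiff d k N L μ (rowDiff d k N L ν (freeOp d k N L j)) p x| * wE d k N L j δ p x := by
        rw [Finset.mul_sum]; exact Finset.sum_congr rfl fun x _ => by ring
    _ ≤ _ := mul_le_mul_of_nonneg_left h (Real.exp_pos _).le

end FreePieces

end Summit.QuantumFields.BalabanUV.Beta.GAN24.FlatResolventPieces
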